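import Summits.Ventures.PercRepro0.Coupling
import Summits.Ventures.PercRepro0.Invariance
import Summits.Ventures.PercRepro0.PlanarT2
import Summits.Ventures.PercRepro0.HighD

/-!
# LEAN CERTIFICATE of the declared PARTIAL PROOF (seat p5; PLAN-lead-g1-v1 §2)

One kernel-checked theorem on the cell's definitions (`Defs.lean`) whose hypotheses are EXACTLY the route's
named paper statements not yet kernel-checked, and whose conclusion is the declared content
`T2_Planar ∧ THD` — i.e. `θ_2(p_c(2)) = 0 ∧ p_c(2) = ½` and `∀ d ≥ 11, θ_d(p_c(d)) = 0`; and, given the residual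
`TMID` as a further hypothesis, the brief's `Target` (via `Defs.R0_regime_split`).

Composition: `PlanarT2.T2_Planar_of` (p4) and `HighD.THD_of_chain` (p3), with their already-formalised inputs
discharged here from the landed modules: monotonicity of `θ_2` (L1, `Coupling.monotoneOn_theta`),
`θ_2(1) > 0` (`Events.theta_one`), measurability of `{≤ 1 infinite cluster}` and `{x ↔ ∞}` (F1, `Events`),
and `P_p(x ↔ ∞) = P_p(0 ↔ ∞)` (F2, `Invariance`).

Hypotheses left (each a ROUTE statement in its `Defs` form; «assumed: paper-proved here, not kernel-checked»,
except `H1_Triangle11`, which is PUBLISHED and stays a hypothesis forever):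
`H1_Triangle11`, `∀ d, P3_Unique d`, `∀ d, P7_FKG d`, `P1_Harris`, `P5_Sharpness 2`, and the crossing bound
`hcross` of T2-assembly-p4-v2 §4 Step 2 (P6(a) Theorem 4.4 + Lemma 2.2 + F2 + the union bound).
No definitions; no axioms beyond the standard three.
-/

namespace Summit.Ventures.PercRepro0.Certificate

open Summit.Ventures.PercRepro0.Defs Set

/-- F2 in the form `HighD.THD_of_chain` consumes: `P_p(x ↔ ∞) = P_p(0 ↔ ∞)` (translation invariance). -/
theorem P_connInf_eq_P_percolates (d : ℕ) (p : unitInterval) (x : Vertex d) :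
    P d p {ω : Config d | ConnInf d ω x} = P d p (percolates d) := by
  rw [← preimage_shiftConfig_percolates x, P_shiftConfig_preimage x p measurableSet_percolates]

/-- `θ_2(1) > 0` (from `θ_2(1) = 1`). -/
theorem theta_two_one_pos : 0 < theta 2 1 := by
  rw [theta_one (by norm_num)]
  exact one_pos

/-- **The certificate.** Hypotheses = the route's paper statements not yet kernel-checked (in their `Defs` forms);
conclusion = the declared content of DECLARATION PARTIAL PROOF: `T2_Planar ∧ THD`. -/
theorem partialProof_of (hH1 : H1_Triangle11) (hP3 : ∀ d, P3_Unique d) (hP7 : ∀ d, P7_FKG d)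
    (hP1 : P1_Harris) (hP5 : P5_Sharpness 2)
    (hcross : ∀ n : ℕ, 1 ≤ n →
      (1 : ℝ) / 2 ≤ ((n : ℝ) + 1) * (P 2 (clamp (1 / 2)) (toBoundary 2 (n + 1))).toReal) :
    T2_Planar ∧ THD :=
  ⟨PlanarT2.T2_Planar_of monotoneOn_theta theta_two_one_pos hP1 hP5 hcross,
    HighD.THD_of_chain hH1 hP3 hP7 (fun d => measurableSet_atMostOneInfCluster (d := d))
      (fun d y => measurableSet_connInf (d := d) y) (fun d p x => P_connInf_eq_P_percolates d p x)⟩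

/-- The brief's `Target` from the same hypotheses plus the residual `TMID` (by `Defs.R0_regime_split`). -/
theorem target_of (hH1 : H1_Triangle11) (hP3 : ∀ d, P3_Unique d) (hP7 : ∀ d, P7_FKG d)
    (hP1 : P1_Harris) (hP5 : P5_Sharpness 2)
    (hcross : ∀ n : ℕ, 1 ≤ n →
      (1 : ℝ) / 2 ≤ ((n : ℝ) + 1) * (P 2 (clamp (1 / 2)) (toBoundary 2 (n + 1))).toReal)
    (hMID : TMID) : Target :=
  R0_regime_split (partialProof_of hH1 hP3 hP7 hP1 hP5 hcross).1
    (partialProof_of hH1 hP3 hP7 hP1 hP5 hcross).2 hMID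

end Summit.Ventures.PercRepro0.Certificate
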